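/-
Origin: expansion seat `planner-pub-hodgecm-toy-0`, handover #2 2026-08-18T04:13:45Z (`HOME/pub-hodgecm-toy/lean/Toy/Theta.lean`, md5 bc528fad, 98 lines);
landed by the gen-5 packager in gate run 21 as `HodgeCM/Model/Toy/Theta.lean` (import ^import Toy\.→import HodgeCM.Model.Toy. ×1).
-/
-- HANDOVER (planner-pub-hodgecm-toy-0, unit pub-hodgecm-toy): WIP module `Toy.Theta`; intended final module
-- `HodgeCM.Model.Toy.Theta` (kind L5, toy model / consistency witness); rename `import Toy.X` ↦ the final prefix.
/-
Copyright: pub-hodgecm cell (HodgeCMPerL). Consistency-witness layer (part (e), referee A G4).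

# No theta realisation in the toy universe; non-vacuity of the open inputs

In `toyModelWith D` the Picard modular surface has `H¹ = 0` (`pmsObj` has no atom), so the field
`lineField` of `ThetaRealisation` (a wedge-function of two one-forms that is not identically zero) has NO
witness: `ThetaRealisation ι₁ V K Ψ σ` is EMPTY for every parameter tuple. Consequently the open inputs
`RealisationExistsFace` / `RealisationExistsPerL` FAIL in the toy universe as soon as their parameter data
exist (a Galois CM field of degree `≥ 6` with a face, an admissible embedding and a hermitian 3-space; resp. a
PerL datum) — so `OpenInputs` is not a consequence of `ModelAxioms`, and its realisation fields are not
provable from `False`-elimination artefacts of the typing.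
-/
import Mathlib
import Summits.HodgeConjecture.HodgeCM.StubTree.Inputs
import Summits.HodgeConjecture.HodgeCM.Model.Toy.Axioms

/-! PORT of `HodgeCM/Model/Toy/Theta.lean` (HodgeCMPerL run 82) — verbatim mechanical port; provenance in the PORT header line. -/

namespace HodgeCM.Toy

open Literature.AlgebraicGeometry.Motives
open scoped TensorProduct
open exteriorPower CMPresentation

noncomputable section

variable (D : HodgeData)

/-- `H¹(P_Γ, ℚ) = ⋀¹ (Empty → _) = 0` in the toy universe. -/
instance subsingleton_coh_pms : Subsingleton ↥(⋀[ℚ]^1 pmsObj.L) :=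
  (oneEquiv ℚ pmsObj.L).toEquiv.subsingleton

/-- (Ported verbatim from the HodgeCMPerL package; no docstring in the source.) -/
lemma cohC_pms_eq_zero {L : CMField} {ι₁ : L →+* ℂ} {V : HermSpace3 L ι₁} (Γ : Level V)
    (ω : (toyModelWith D).CohC ((toyModelWith D).pms L ι₁ V Γ) 1) : ω = 0 := by
  change ℂ ⊗[ℚ] ↥(⋀[ℚ]^1 pmsObj.L) at ω
  induction ω using TensorProduct.induction_on with
  | zero => rfl
  | tmul c v => rw [Subsingleton.elim v 0, TensorProduct.tmul_zero]
  | add x y hx hy => rw [hx, hy, add_zero]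

/-- **No theta realisation exists in the toy universe**: the field `lineField` has no witness. -/
theorem isEmpty_thetaRealisation {L : CMField} (ι₁ : L →+* ℂ) (V : HermSpace3 L ι₁)
    (K : CMField) (Ψ : Fin 4 → CMType K) (σ : K →+* ℂ) :
    IsEmpty ((toyModelWith D).ThetaRealisation ι₁ V K Ψ σ) := by
  refine ⟨fun R => ?_⟩
  obtain ⟨Γ, ω₁, -, ω₂, -, hne⟩ := R.lineField
  apply hne
  rw [cohC_pms_eq_zero D Γ ω₁, cohC_pms_eq_zero D Γ ω₂, map_zero]

/-- **A face datum**: a Galois CM field of degree `≥ 6`, a face, an admissible embedding, a hermitian 3-space.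
(Exists: e.g. `F = ℚ(ζ₇)` with any rank-four face; not constructed here.) -/
structure FaceDatum : Type 1 where
  F : CMField
  gal : IsGalois ℚ F
  six : 6 ≤ Module.finrank ℚ F
  f : Face F
  ι₁ : (F : Type) →+* ℂ
  adm : f.Admissible ι₁
  V : HermSpace3 F ι₁

/-- In the toy universe `RealisationExistsFace` fails as soon as a face datum exists. -/
theorem not_realisationExistsFace (d : FaceDatum) : ¬ (toyModelWith D).RealisationExistsFace := by
  intro h
  obtain ⟨R⟩ := h d.F d.gal d.six d.f d.ι₁ d.adm d.V
  exact (isEmpty_thetaRealisation D d.ι₁ d.V d.F d.f.psi d.ι₁).false R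

/-- **A PerL datum**: the parameter data of `RealisationExistsPerL` (sextic `K`, its Galois closure `L` of
degree 24 or 48, a frame, `ι₁`, PerL types, a hermitian 3-space). -/
structure PerLDatum : Type 1 where
  K : CMField
  L : CMField
  j : (K : Type) →+* (L : Type)
  normal : IsNormalClosure ℚ K L
  six : Module.finrank ℚ K = 6
  deg : Module.finrank ℚ L = 24 ∨ Module.finrank ℚ L = 48
  φ : Fin 3 → ((K : Type) →+* ℂ)
  frame : IsFrame φ
  ι₁ : (L : Type) →+* ℂ
  compat : ι₁.comp j = φ 0
  t : Fin 4 → CMType K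
  types : IsPerLTypes φ t
  V : HermSpace3 L ι₁

/-- In the toy universe `RealisationExistsPerL` fails as soon as a PerL datum exists. -/
theorem not_realisationExistsPerL (d : PerLDatum) : ¬ (toyModelWith D).RealisationExistsPerL := by
  intro h
  obtain ⟨R⟩ := h d.K d.L d.j d.normal d.six d.deg d.φ d.frame d.ι₁ d.compat d.t d.types d.V
  exact (isEmpty_thetaRealisation D d.ι₁ d.V d.K d.t (d.φ 0)).false R

/-- Hence `OpenInputs` fails in the toy universe (given a face datum): the open inputs are NOT consequences of
the model axioms, and are not vacuously true. -/
theorem not_openInputs (d : FaceDatum) : ¬ (toyModelWith D).OpenInputs := fun h =>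
  not_realisationExistsFace D d h.realisation_face

end

end HodgeCM.Toy
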